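import Mathlib.Analysis.Normed.Algebra.MatrixExponential
import Mathlib.LinearAlgebra.Matrix.Kronecker
import Mathlib.LinearAlgebra.Matrix.Reindex
import HarnessLib

/-!
# The exponential of a Kronecker sum: `e^{A ⊕ B} = e^A ⊗ e^B` (Bernstein, Prop. 11.1.7)

**Source.** D. S. Bernstein, *Matrix Mathematics* (2nd ed., Princeton 2009) [Bernstein2009]:
Definition 7.2.1 (the Kronecker sum `A ⊕ B := A ⊗ I_m + I_n ⊗ B` of `A ∈ 𝔽^{n×n}`, `B ∈ 𝔽^{m×m}`)
and Proposition 11.1.7 (p. 709): `e^{A ⊗ I_m} = e^A ⊗ I_m` (11.1.14), `e^{I_n ⊗ B} = I_n ⊗ e^B`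
(11.1.15), `e^{A ⊕ B} = e^A ⊗ e^B` (11.1.16); printed proof: the power series of `e^{A ⊗ I}`
factors through `(A ⊗ I)^k = A^k ⊗ I`, the two summands of `A ⊕ B` commute because both products
equal `A ⊗ B`, hence `e^{A ⊕ B} = e^{A⊗I} e^{I⊗B} = (e^A ⊗ I)(I ⊗ e^B) = e^A ⊗ e^B`.

**What is here (all proved).** `kroneckerSum`; the algebra of the two summands over any commutative
semiring (`kronecker_one_mul_one_kronecker`, `one_kronecker_mul_kronecker_one`,
`commute_kronecker_one_one_kronecker`, `kronecker_one_pow`, `one_kronecker_pow`); and, for square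
matrices over a complete normed `ℚ`-algebra `𝔸` (e.g. `ℝ`, `ℂ`; Mathlib's `NormedSpace.exp`, norm on
matrices hidden as in `Mathlib.Analysis.Normed.Algebra.MatrixExponential`): `exp_kronecker_one`
(11.1.14, via Mathlib's `Matrix.exp_blockDiagonal` and `kronecker_one`), `exp_reindex` (the matrix
exponential commutes with re-indexing — `map_exp` for the continuous algebra equivalence
`Matrix.reindexAlgEquiv`), `exp_one_kronecker` (11.1.15), `exp_kroneckerSum` (11.1.16) and the
time-`t` form `exp_smul_kroneckerSum` (`e^{t(A ⊕ B)} = e^{tA} ⊗ e^{tB}`).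
Rank-one (separable) data: `kronecker_mulVec_tensor` — `(A ⊗ B)(x ⊗ y) = (Ax) ⊗ (By)`, the vector
case of Prop. 7.1.6 (7.1.12), as Bernstein uses it in the proof of Prop. 7.1.10 — and its
consequences `exp_kroneckerSum_mulVec_tensor` / `exp_smul_kroneckerSum_mulVec_tensor`
(`e^{t(A ⊕ B)}(x ⊗ y) = (e^{tA}x) ⊗ (e^{tB}y)`: separable initial data stay separable, so the
`(m·n)`-dimensional evolution is two small ones).

Why it is here: separable (uncoupled) linear evolution equations discretised on tensor grids have
generators that are Kronecker sums, so their solution operators factor into 1-D solution operators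
(`pub-qadeq` rows A-121 / A-126 and the DEQ-A80 lineage use exactly this on the classical side).

## References

* D. S. Bernstein, *Matrix Mathematics: Theory, Facts, and Formulas*, 2nd ed., Princeton University
  Press (2009), Def. 7.2.1 and Prop. 11.1.7. [Bernstein2009]
-/

namespace Literature.Analysis.Matrix.KroneckerSum

open scoped Kronecker
open NormedSpace

variable {m n : Type*} [Fintype m] [DecidableEq m] [Fintype n] [DecidableEq n]
variable {𝔸 : Type*}

section CommSemiring

variable [CommSemiring 𝔸]

/-- **Kronecker sum** `A ⊕ B := A ⊗ I + I ⊗ B` of square matrices `A` (`m × m`) and `B` (`n × n`),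
an `(m × n) × (m × n)` matrix. [cite: Bernstein2009, Def. 7.2.1 (7.2.1)] -/
def kroneckerSum (A : Matrix m m 𝔸) (B : Matrix n n 𝔸) : Matrix (m × n) (m × n) 𝔸 :=
  A ⊗ₖ (1 : Matrix n n 𝔸) + (1 : Matrix m m 𝔸) ⊗ₖ B

/-- `(A ⊗ I)(I ⊗ B) = A ⊗ B`. [cite: Bernstein2009, proof of Prop. 11.1.7] -/
theorem kronecker_one_mul_one_kronecker (A : Matrix m m 𝔸) (B : Matrix n n 𝔸) :
    A ⊗ₖ (1 : Matrix n n 𝔸) * (1 : Matrix m m 𝔸) ⊗ₖ B = A ⊗ₖ B := by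
  rw [← Matrix.mul_kronecker_mul, Matrix.mul_one, Matrix.one_mul]

/-- `(I ⊗ B)(A ⊗ I) = A ⊗ B`. [cite: Bernstein2009, proof of Prop. 11.1.7] -/
theorem one_kronecker_mul_kronecker_one (A : Matrix m m 𝔸) (B : Matrix n n 𝔸) :
    (1 : Matrix m m 𝔸) ⊗ₖ B * A ⊗ₖ (1 : Matrix n n 𝔸) = A ⊗ₖ B := by
  rw [← Matrix.mul_kronecker_mul, Matrix.one_mul, Matrix.mul_one]

/-- The two summands of a Kronecker sum commute ("which shows that `A ⊗ I_m` and `I_n ⊗ B`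
commute"). [cite: Bernstein2009, proof of Prop. 11.1.7] -/
theorem commute_kronecker_one_one_kronecker (A : Matrix m m 𝔸) (B : Matrix n n 𝔸) :
    Commute (A ⊗ₖ (1 : Matrix n n 𝔸)) ((1 : Matrix m m 𝔸) ⊗ₖ B) := by
  rw [Commute, SemiconjBy, kronecker_one_mul_one_kronecker, one_kronecker_mul_kronecker_one]

/-- `(A ⊗ I)^k = A^k ⊗ I`. [cite: Bernstein2009, proof of Prop. 11.1.7 (the series step)] -/
theorem kronecker_one_pow (A : Matrix m m 𝔸) (k : ℕ) :
    (A ⊗ₖ (1 : Matrix n n 𝔸)) ^ k = (A ^ k) ⊗ₖ (1 : Matrix n n 𝔸) := by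
  induction k with
  | zero => rw [pow_zero, pow_zero, Matrix.one_kronecker_one]
  | succ k ih => rw [pow_succ, ih, ← Matrix.mul_kronecker_mul, Matrix.one_mul, pow_succ]

/-- `(I ⊗ B)^k = I ⊗ B^k`. [cite: Bernstein2009, proof of Prop. 11.1.7 ("and similarly for (11.1.15)")] -/
theorem one_kronecker_pow (B : Matrix n n 𝔸) (k : ℕ) :
    ((1 : Matrix m m 𝔸) ⊗ₖ B) ^ k = (1 : Matrix m m 𝔸) ⊗ₖ (B ^ k) := by
  induction k with
  | zero => rw [pow_zero, pow_zero, Matrix.one_kronecker_one]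
  | succ k ih => rw [pow_succ, ih, ← Matrix.mul_kronecker_mul, Matrix.one_mul, pow_succ]

omit [Fintype m] [Fintype n] in
/-- `t (A ⊕ B) = (tA) ⊕ (tB)`. [cite: Bernstein2009, Def. 7.2.1] -/
theorem smul_kroneckerSum (t : 𝔸) (A : Matrix m m 𝔸) (B : Matrix n n 𝔸) :
    t • kroneckerSum A B = kroneckerSum (t • A) (t • B) := by
  rw [kroneckerSum, kroneckerSum, smul_add, Matrix.smul_kronecker, Matrix.kronecker_smul]

omit [DecidableEq m] [DecidableEq n] in
/-- Kronecker (tensor) product of two coordinate vectors, `(x ⊗ y)(i,j) = x i · y j`, written as a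
plain function on `m × n` (no new definition). **`(A ⊗ B)(x ⊗ y) = (Ax) ⊗ (By)`** — the vector case
of `(A ⊗ B)(C ⊗ D) = AC ⊗ BD`. [cite: Bernstein2009, Prop. 7.1.6 (7.1.12); used verbatim in the proof of Prop. 7.1.10] -/
theorem kronecker_mulVec_tensor (A : Matrix m m 𝔸) (B : Matrix n n 𝔸) (x : m → 𝔸) (y : n → 𝔸) :
    (A ⊗ₖ B).mulVec (fun p : m × n => x p.1 * y p.2) = fun p => (A.mulVec x) p.1 * (B.mulVec y) p.2 := by
  funext p
  simp only [Matrix.mulVec, dotProduct, Matrix.kroneckerMap_apply]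
  rw [Fintype.sum_prod_type, Finset.sum_mul_sum]
  refine Finset.sum_congr rfl fun i _ => Finset.sum_congr rfl fun j _ => ?_
  ring

/-- `(A ⊕ B)(x ⊗ y) = (Ax) ⊗ y + x ⊗ (By)` (the Kronecker sum acts as a derivation on separable
vectors). [cite: Bernstein2009, Def. 7.2.1 with Prop. 7.1.6 (7.1.12)] -/
theorem kroneckerSum_mulVec_tensor (A : Matrix m m 𝔸) (B : Matrix n n 𝔸) (x : m → 𝔸) (y : n → 𝔸) :
    (kroneckerSum A B).mulVec (fun p : m × n => x p.1 * y p.2) =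
      fun p => (A.mulVec x) p.1 * y p.2 + x p.1 * (B.mulVec y) p.2 := by
  rw [kroneckerSum, Matrix.add_mulVec, kronecker_mulVec_tensor, kronecker_mulVec_tensor,
    Matrix.one_mulVec, Matrix.one_mulVec]
  rfl

end CommSemiring

section Exp

variable [NormedCommRing 𝔸] [NormedAlgebra ℚ 𝔸] [CompleteSpace 𝔸]

-- As in `Mathlib.Analysis.Normed.Algebra.MatrixExponential` (`Matrix.exp_add_of_commute` etc.), the
-- proofs below open the scoped `L^∞`-operator norm on matrices locally and need
-- `backward.isDefEq.respectTransparency false` so that the norm-induced uniform structure is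
-- recognised as the product one (lean4#10414); the STATEMENTS mention no norm.

set_option backward.isDefEq.respectTransparency false in
/-- **Bernstein (11.1.14): `e^{A ⊗ I} = e^A ⊗ I`.** [cite: Bernstein2009, Prop. 11.1.7 (11.1.14)] -/
theorem exp_kronecker_one (A : Matrix m m 𝔸) :
    exp (A ⊗ₖ (1 : Matrix n n 𝔸)) = exp A ⊗ₖ (1 : Matrix n n 𝔸) := by
  rw [Matrix.kronecker_one, Matrix.exp_blockDiagonal, Matrix.kronecker_one]
  congr 1
  open scoped Matrix.Norms.Operator in exact Pi.exp_def (fun _ : n => A)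

set_option backward.isDefEq.respectTransparency false in
/-- The matrix exponential commutes with re-indexing along an equivalence (conjugation by a
permutation of coordinates). [cite: Bernstein2009, Prop. 11.1.7 (used for (11.1.15): `I ⊗ B` is a re-indexed block-diagonal matrix)] -/
theorem exp_reindex (e : m ≃ n) (A : Matrix m m 𝔸) :
    exp (Matrix.reindex e e A) = Matrix.reindex e e (exp A) := by
  open scoped Matrix.Norms.Operator in
  have h := map_exp (Matrix.reindexAlgEquiv ℚ 𝔸 e) (continuous_id.matrix_reindex e e) A
  simp only [Matrix.coe_reindexAlgEquiv] at h
  exact h.symm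

set_option backward.isDefEq.respectTransparency false in
/-- **Bernstein (11.1.15): `e^{I ⊗ B} = I ⊗ e^B`.** [cite: Bernstein2009, Prop. 11.1.7 (11.1.15)] -/
theorem exp_one_kronecker (B : Matrix n n 𝔸) :
    exp ((1 : Matrix m m 𝔸) ⊗ₖ B) = (1 : Matrix m m 𝔸) ⊗ₖ exp B := by
  rw [Matrix.one_kronecker, exp_reindex, Matrix.exp_blockDiagonal, Matrix.one_kronecker]
  congr 2
  open scoped Matrix.Norms.Operator in exact Pi.exp_def (fun _ : m => B)

/-- **Bernstein (11.1.16): the exponential of a Kronecker sum is the Kronecker product of the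
exponentials, `e^{A ⊕ B} = e^A ⊗ e^B`.** [cite: Bernstein2009, Prop. 11.1.7 (11.1.16)] -/
theorem exp_kroneckerSum (A : Matrix m m 𝔸) (B : Matrix n n 𝔸) :
    exp (kroneckerSum A B) = exp A ⊗ₖ exp B := by
  rw [kroneckerSum, Matrix.exp_add_of_commute _ _ (commute_kronecker_one_one_kronecker A B),
    exp_kronecker_one, exp_one_kronecker, kronecker_one_mul_one_kronecker]

/-- Time-`t` form: `e^{t(A ⊕ B)} = e^{tA} ⊗ e^{tB}` — the solution operator of the uncoupled
linear system `u' = (A ⊕ B) u` factors into the two one-dimensional solution operators.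
[cite: Bernstein2009, Prop. 11.1.7 (11.1.16) with Def. 7.2.1] -/
theorem exp_smul_kroneckerSum (t : 𝔸) (A : Matrix m m 𝔸) (B : Matrix n n 𝔸) :
    exp (t • kroneckerSum A B) = exp (t • A) ⊗ₖ exp (t • B) := by
  rw [smul_kroneckerSum, exp_kroneckerSum]

/-- **Separable data stay separable: `e^{A ⊕ B}(x ⊗ y) = (e^A x) ⊗ (e^B y)`.**
[cite: Bernstein2009, Prop. 11.1.7 (11.1.16) with Prop. 7.1.6 (7.1.12)] -/
theorem exp_kroneckerSum_mulVec_tensor (A : Matrix m m 𝔸) (B : Matrix n n 𝔸) (x : m → 𝔸)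
    (y : n → 𝔸) :
    (exp (kroneckerSum A B)).mulVec (fun p : m × n => x p.1 * y p.2) =
      fun p => ((exp A).mulVec x) p.1 * ((exp B).mulVec y) p.2 := by
  rw [exp_kroneckerSum, kronecker_mulVec_tensor]

/-- Time-`t` form: the solution `e^{t(A ⊕ B)}(x ⊗ y)` of `u' = (A ⊕ B)u`, `u(0) = x ⊗ y`, is the tensor
product `(e^{tA}x) ⊗ (e^{tB}y)` of the two small solutions — an `(m·n)`-dimensional separable
evolution costs one `m`- and one `n`-dimensional evolution.
[cite: Bernstein2009, Prop. 11.1.7 (11.1.16) with Prop. 7.1.6 (7.1.12) and Def. 7.2.1] -/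
theorem exp_smul_kroneckerSum_mulVec_tensor (t : 𝔸) (A : Matrix m m 𝔸) (B : Matrix n n 𝔸)
    (x : m → 𝔸) (y : n → 𝔸) :
    (exp (t • kroneckerSum A B)).mulVec (fun p : m × n => x p.1 * y p.2) =
      fun p => ((exp (t • A)).mulVec x) p.1 * ((exp (t • B)).mulVec y) p.2 := by
  rw [exp_smul_kroneckerSum, kronecker_mulVec_tensor]

end Exp

end Literature.Analysis.Matrix.KroneckerSum
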